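import Literature.MathematicalPhysics.QuantumFieldTheory.Balaban1983to89.B4Eq411Remainder
import Literature.MathematicalPhysics.QuantumFieldTheory.Balaban1983to89.B4Ineq412ConstField

/-!
# `Balaban1983to89.B4Ineq47TwoBlock` — T. Bałaban, *Regularity and decay of lattice Green's functions*, Commun. Math.
# Phys. **89** (1983) 571–597 [Balaban1983RegularityDecay], §4 pp. 590–591 [PDF 20–21]: **(4.7) for a general regular
# field `A = A₀ + A′` on the two-block region `Δ(x,x′)`** — «this [(4.12)] together with (4.11) with δ = ½γ₀″ and (4.13)
# give (4.7) with γ₀′ = ¼γ₀″» — PROVED as a kernel theorem on the model (flow `e^{tq}` of (1.2), two-block Neumann box,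
# [B4]'s weights), by assembling (4.11) (`B4Ineq410FirstOrder` + `B4Eq411Remainder`), (4.12) (r01's
# `B4Ineq412ConstField`, TRANSPORTED to the box carrier by a relabelling theorem for the left side of (4.7)) and (4.13)
# (r01's `B4Ineq410GaugeOut.ineq413_transport`) through r01's bookkeeping `B4Ineq410GaugeOut.ineq47_of_412`

statement-level skeleton of published theorems with citation tags; proofs where landed; nothing here is a claim about the Yang–Mills mass gap

PDF held: `paper:balaban1983-cmp89-regularity-decay` (renders `run/shared/lean/pub/pub-balaban/b2b-balaban-ref1/pages/
1983-cmp89-regularity-decay/1983-cmp89-regularity-decay-p020-x2.png`, `…-p021-x2.png`, READ AS IMAGES; journal page =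
PDF page + 570).

CITATION HEADER (lean-in-tree rule).  lit-balaban cell (HOME `run/shared/lean/pub/lit-balaban/`), block B4 (fold
owner r01), SKELETON rows **`B4.Eq4.7`** / **`B4.Eq4.11`** ((4.7); (4.8)–(4.13)); written by the block's second reader,
unit `lit-balaban-r04` gen 12 (free-target protocol, TAKING 2026-08-22T07:32Z, r01 named).  Closing file of the
programme `B4Eq48FirstOrder` ((4.8)) → `B4Eq49TwoBlockGreen` ((4.9)) → `B4Ineq410FirstOrder` ((4.10)) →
`B4Eq47Expansion` → `B4Eq411Remainder` ((4.11)) → THIS FILE ((4.7) ⇐ (4.11) + (4.12) + (4.13)).  Inputs USED BY NAME,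
not re-proved: `B4Ineq410FirstOrder.ineq410_first_constBond` ((4.10), first inequality), `B4Eq411Remainder.
remainder_bound_constBond` (the second-order remainder), r01's `B4Ineq412ConstField.ineq412_constBond_gen` ((4.12) for
every constant field, block embedding and admissible contour system, on the fine-region carrier `fineDom n (pair y₀ μ)`)
with its weights `regWt`/`blkWtR`/`outWt`, r01's `B4Ineq410GaugeOut` (`lhs47`, `qgq`, `delta_split`, `ineq47_of_412` —
which runs through `B4.gamma0prime_chain` —, `ineq413_transport`, `transport_constBond`), `B4Ineq414TwoBlock.pair`,
`B4Lower18.fineDom_boxDom`, `B4Eq49TwoBlockGreen` (`twoBlk`, `mem_boxDom_twoBlk`), `B4Eq12ExpFlow.expFlow_lipschitz`,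
`B4GaugeCovariance` ((1.3)–(1.6), `constBond`, `boxWt`, `blkWt`), `B4Lemma21Region.siteNorm`/`B4Lemma22Reduce231.
siteNorm_sq`, Mathlib's `Matrix.submatrix` calculus (`submatrix_mul_equiv`, `inv_submatrix_equiv`,
`submatrix_mulVec_equiv`, `submatrix_one_equiv`).

## THE PRINT (verbatim, p. 590 [PDF 20] – p. 591 [PDF 21]; `≦` written `≤`)

p. 590: *"… and the inequality (4.3) will be proved if we prove that for each pair ⟨x,x′⟩ ⊂ T₁^{(k)}
a_k|φ(x)|² + a_k|φ(x′)|² − a_k²⟨φ, Q_k(A)G_k(Δ(x,x′),A)Q_k^*(A)φ⟩ ≥ γ₀′|U(A(⟨x,x′⟩))φ(x′) − φ(x)|²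
− O(1)e²p²(e)(|φ(x)|² + |φ(x′)|²) (4.7) with a positive constant γ₀′ independent of k, ⟨x,x′⟩, and A. … To prove (4.7)
for general, regular A we represent A as a sum A₀ + A′, where A₀ is a constant field, A₀ = A(y₀) for some y₀ ∈ Δ(x,x′),
and |A′|, |∂^η_μA′| ≤ O(1)p(e) on Δ(x,x′)."*   p. 591: *"Thus we get (the left hand side of (4.7)) ≥ (the left hand side
of (4.7) with A replaced by A₀) − δ|U(A₀(⟨x,x′⟩))φ(x′) − φ(x)|² − O(δ^{−1})e²p²(e)(|φ(x)|² + |φ(x′)|²). (4.11)  Now it is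
sufficient to prove (the left hand side of (4.7) with A replaced by A₀) ≥ γ₀″|U(A₀(⟨x,x′⟩))φ(x′) − φ(x)|², (4.12)
because this together with (4.11) with δ = ½γ₀″ and |U(A₀(⟨x,x′⟩))φ(x′) − φ(x)|² ≥ ½|U(A(⟨x,x′⟩))φ(x′) − φ(x)|²
− O(1)e²p²(e)|φ(x)|² (4.13) give (4.7) with γ₀′ = ¼γ₀″."*

## WHAT IS CERTIFIED (kernel theorems and one `def` with body (`bondContour`, v1.1); zero `sorry`, standard axioms;
## no `Prop`-valued statement is introduced)

* §1 **`lhs47_reindex`** — THE LEFT SIDE OF (4.7) IS INVARIANT UNDER RELABELLING of the sites (`eX : X′ ≃ X`) and of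
  the block labels (`eY : Y′ ≃ Y`), all data transported along (bond weights, inner/outer block weights, block sites,
  contours, field, `φ`): the operator (1.6), its inverse (1.6)′, the averaging operators (1.4) and the sandwich
  `Q_kG_kQ_k^*` all become `Matrix.submatrix`es (private `bondDiff_reindex`, `covLap_reindex`, `transport_reindex`,
  `contourTrans_reindex`, `b4Op_reindex`).
* §2 `pair_zero_eq` (`{x,x′} = {0, e_μ}` IS the unit box of trace `twoBlk μ`), `fineDom_pair_zero_eq` (its fine region
  IS the fine box `Δ(x,x′)`), and **`ineq412_box`** — (4.12) FOR EVERY CONSTANT FIELD ON THE BOX CARRIER of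
  `B4Ineq410FirstOrder.lhs47Box` (every block embedding, every contour system whose weighted contours end at the
  averaged site): `min(a_k/(8(d+1) + 2m²), 1/8)·|U(κA₀(emb x → emb x′))φ(x′) − φ(x)|² ≤ LHS(4.7)(A₀)`; r01's theorem
  moved along the two identifications by `lhs47_reindex` (the weights agree pointwise by `rfl`).
* §3 **`ineq47_box`** — (4.7) FOR `A = A₀ + A′`: there are `γ > 0`, `C ≥ 0`, depending on `d`, `q` and the window
  `[a₋,a₊] × [0,m²₊]` only, such that for all `n ≥ 1`, `a_k ∈ [a₋,a₊]`, `m² ∈ [0,m²₊]`, every direction `μ`, coupling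
  `κ`, block sites `emb`, nearest-neighbour block contours `Γ_{y,z}` of length `≤ (d+1)n` ending at their targets, every
  constant `A₀`, every `A′` with `n|κA′_b| ≤ ε₁` on bonds and `|κA′(Γ_{y,z})| ≤ ε₂` on contours, under the smallness
  `ℓ²ε₁²(d+1)(1+a_k(d+1)) ≤ min(2,a_k)/4`, every nearest-neighbour contour `Γ_{x,x′}` from `emb x` to `emb x′` of
  length `≤ 2(d+1)n` and every `φ`:
  `γ|U(κA(Γ_{x,x′}))φ(x′) − φ(x)|² − C(ε₁+ε₂)²(|φ(x)|² + |φ(x′)|²) ≤ a_k|φ|² − a_k²⟨φ, Q_k(A)G_k(Δ(x,x′),A)Q_k^*(A)φ⟩`,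
  with `γ = ¼γ₀″`, `γ₀″ = min(a₋/(8(d+1) + 2max(m²₊,0)), 1/8)`, `C = ½γ₀″K′ + K²/γ₀″ + K_R`, `K` of (4.10), `K_R` of
  the remainder, `K′ = 4(d+1)²ℓ²`.  Proof = the print's sentence: `ineq47_of_412` with `hdec` (`L = L₀ + F + R`,
  `ring`), `hF` ((4.10) + `delta_split` at `δ = ½γ₀″`), `hR` (`remainder_bound_constBond`), `h412` (`ineq412_box`,
  `γ₀″ ≤ min(a_k/(8(d+1)+2m²), 1/8)` on the window), `h413` (`ineq413_transport` along `Γ_{x,x′}` with the bond size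
  `ε₁/n` and `|Γ_{x,x′}|·ε₁/n ≤ 2(d+1)ε₁`, `transport_constBond`: the `A₀`-transporter along `Γ_{x,x′}` IS
  `U(κA₀(emb x → emb x′))`).

* §4 (v1.1) THE CANONICAL DATA: `bondContour` (the straight nearest-neighbour contour `Γ_{x,x′}` from the base corner
  `n·x = 0` to `n·x′ = n·e_μ`, a `def` with body; `bondContour_nn`, `bondContour_end`, `bondContour_length`) and
  **`ineq47_box_canonical`** — (4.7) for `A = A₀ + A′` with block averages based at the corners `n·y`
  (`B4Lower18Regular.baseEmb`), [B4]'s staircase contours `Γ^{(k)}_{y,z}` (`B4Lower18Regular.stairContour`, whose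
  `hend`/`hnn`/`hlen` are theorems there), the bond contour `Γ_{x,x′}`, and the contour bound `|κA′(Γ_{y,z})| ≤ (d+1)ε₁`
  DERIVED from the bond bound (`abs_lsum_le`): the ONLY hypotheses left are the window, `n|κA′_b| ≤ ε₁` («|A′| ≤
  O(1)p(e)») and the Lemma-2.1 smallness; conclusion (4.7) with `O(1)e²p²(e) = C(d+2)²·ε₁²`.

## DICTIONARY (print ↦ Lean; as in `B4Ineq410FirstOrder`/`B4Eq411Remainder`)

`U(A(⟨x,x′⟩))` ↦ `transport (fieldLink (expFlow q hq) κ (constBond A₀ Subtype.val + A′)) (emb x) Γ_{x,x′}` (the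
transporter of the full field along a nearest-neighbour contour from the block site of `x` to that of `x′`; for the
constant part it depends on the end-points only, `transport_constBond`); `U(A₀(⟨x,x′⟩))` ↦ `(expFlow q hq).U
(κ·constBond A₀ Subtype.val (emb x) (emb x′))`; `γ₀″` ↦ `min(a₋/(8(d+1) + 2max(m²₊,0)), 1/8)` (r01's (4.14) constant,
made uniform on the window); `O(1)e²p²(e)` ↦ `C(ε₁+ε₂)²`; `Δ(x,x′)`, `{x,x′}` ↦ `boxDom (n·twoBlk μ)`, `boxDom (twoBlk μ)`
(= `fineDom n (pair 0 μ)`, `pair 0 μ` of r01's files, §2).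

## HONEST SCOPE / located readings

(a) HYPOTHESES KEPT EXPLICIT, as in `B4Eq411Remainder`: the Lemma-2.1 smallness, the admissible block contours, the
two field bounds `ε₁`, `ε₂`; NEW here: the contour `Γ_{x,x′}` carrying «U(A(⟨x,x′⟩))» is ANY nearest-neighbour contour
from `emb x` to `emb x′` of length `≤ 2(d+1)n` (print: the bond transporter of the unit lattice `T₁^{(k)}`, i.e. the
straight contour between the block centres; every such contour gives the same `A₀`-part, and the `A′`-part is what
(4.13) absorbs).  (b) `γ`, `C` are explicit in `d`, `ℓ²`, the window and the constants `K` ((4.10)), `K_R` (remainder)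
— themselves explicit polynomials (`B4Ineq410FirstOrder`, `B4Eq411Remainder`) —, uniform in `n`, `μ`, `κ`, `emb`, `Γ`,
`A₀`, `A′`, `φ`: «γ₀′ independent of k, ⟨x,x′⟩, and A».  (c) (4.12) enters through r01's (4.14) WITH the mass kept
(`min(a_k/(8(d+1)+2m²), 1/8)`); the print's «estimate from below by the same expression with m² = 0» is r01's
`lhs47_mass_mono` and is not needed for the stated constant.  (d) v1.1 (§4) only ADDS to v1.0 (§1–§3 byte-identical).
(e) The relabelling theorem §1 is general (any finite
site/label types, any flow, any data) and is the carrier bridge between the box files of this lineage and the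
fine-region files of r01's (4.12)/(4.14) lineage.  (f) No existing module is modified; two `import`s.
-/

namespace Literature.MathematicalPhysics.QuantumFieldTheory.Balaban1983to89.B4Ineq47TwoBlock

open Finset Matrix
open Literature.MathematicalPhysics.QuantumFieldTheory.Balaban1983to89.B4GaugeCovariance
open Literature.MathematicalPhysics.QuantumFieldTheory.Balaban1983to89.B4Ineq410GaugeOut (qgq lhs47)
open Literature.MathematicalPhysics.QuantumFieldTheory.Balaban1983to89.B4Ineq410FirstOrder
  (outWtB firstOrder48Box lhs47Box siteX siteX')
open Literature.MathematicalPhysics.QuantumFieldTheory.Balaban1983to89.B4Eq49TwoBlockGreen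
  (twoBlk mem_boxDom_twoBlk)
open Literature.MathematicalPhysics.QuantumFieldTheory.Balaban1983to89.B4Reflection242 (boxDom nbrs blk)
open Literature.MathematicalPhysics.QuantumFieldTheory.Balaban1983to89.B4BoxCov237 (uvec)
open Literature.MathematicalPhysics.QuantumFieldTheory.Balaban1983to89.B4Lower18 (fineDom fineDom_boxDom)
open Literature.MathematicalPhysics.QuantumFieldTheory.Balaban1983to89.B4Ineq414TwoBlock
  (pair left_mem_pair right_mem_pair)
open Literature.MathematicalPhysics.QuantumFieldTheory.Balaban1983to89.B4Ineq412ConstField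
  (regWt blkWtR outWt ineq412_constBond_gen)
open Literature.MathematicalPhysics.QuantumFieldTheory.Balaban1983to89.B4Lemma21Region (siteNorm)
open Literature.MathematicalPhysics.QuantumFieldTheory.Balaban1983to89.B4Lemma22Reduce231 (siteNorm_sq)
open Literature.MathematicalPhysics.QuantumFieldTheory.Balaban1983to89.B4Eq12ExpFlow (expFlow expFlow_lipschitz)
open Literature.MathematicalPhysics.QuantumFieldTheory.Balaban1983to89.B4Lower18Regular
  (lsum transport_fieldLink PathRel abs_lsum_le baseEmb stairContour stairContour_end stairContour_nn
    stairContour_length blkWt_ne_zero stair pathEnd_stair pathRel_stair length_stair_le mem_stair mem_boxDom_of_between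
    val_pathEnd_pmap pathRel_pmap_iff)
open Literature.MathematicalPhysics.QuantumFieldTheory.Balaban1983to89.B4Ineq410GaugeOut
  (delta_split ineq47_of_412 ineq413_transport transport_constBond)
open Literature.MathematicalPhysics.QuantumFieldTheory.Balaban1983to89.B4Ineq410FirstOrder (ineq410_first_constBond)
open Literature.MathematicalPhysics.QuantumFieldTheory.Balaban1983to89.B4Eq411Remainder (remainder_bound_constBond)

noncomputable section

/-! ## §1. Transport of structure: the left side of (4.7) is invariant under relabelling of sites and block labels -/

section Reindex

variable {X X' Y Y' ι : Type*} [Fintype X] [Fintype X'] [Fintype Y] [Fintype Y'] [Fintype ι]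
  [DecidableEq X] [DecidableEq X'] [DecidableEq ι]

omit [Fintype X] [Fintype X'] [Fintype Y] [Fintype Y'] [Fintype ι] [DecidableEq X] [DecidableEq X'] [DecidableEq ι] in
/-- block operators relabel blockwise. [folklore] -/
private theorem blockOp_reindex (eX : X' ≃ X) (eY : Y' ≃ Y) (K : Y → X → Matrix ι ι ℝ) :
    blockOp (fun y' x' => K (eY y') (eX x')) = (blockOp K).submatrix (eY.prodCongr (Equiv.refl ι)) (eX.prodCongr (Equiv.refl ι)) := by
  ext ⟨y', i⟩ ⟨x', j⟩
  rfl

omit [Fintype X] [Fintype X'] [Fintype Y] [Fintype Y'] [Fintype ι] in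
/-- the bond difference (1.3) relabels. [folklore] -/
private theorem bondDiff_reindex (eX : X' ≃ X) (W : X → X → Matrix ι ι ℝ) (x' y' : X') :
    bondDiff (fun u v => W (eX u) (eX v)) x' y' = (bondDiff W (eX x') (eX y')).submatrix id (eX.prodCongr (Equiv.refl ι)) := by
  ext ⟨u, i⟩ ⟨z', j⟩
  simp only [bondDiff, blockOp_apply, Matrix.submatrix_apply, id_eq, Equiv.prodCongr_apply, Prod.map_apply,
    Equiv.coe_refl, eX.apply_eq_iff_eq]

omit [Fintype Y] [Fintype Y'] in
/-- the covariant Laplacian (1.3) relabels. [folklore] -/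
private theorem covLap_reindex (eX : X' ≃ X) (c : X → X → ℝ) (W : X → X → Matrix ι ι ℝ) :
    covLap (fun u v => c (eX u) (eX v)) (fun u v => W (eX u) (eX v)) = (covLap c W).submatrix (eX.prodCongr (Equiv.refl ι)) (eX.prodCongr (Equiv.refl ι)) := by
  unfold covLap
  have hterm : ∀ x' y' : X', c (eX x') (eX y') • ((bondDiff (fun u v => W (eX u) (eX v)) x' y')ᵀ
      * bondDiff (fun u v => W (eX u) (eX v)) x' y')
      = (c (eX x') (eX y') • ((bondDiff W (eX x') (eX y'))ᵀ * bondDiff W (eX x') (eX y'))).submatrix (eX.prodCongr (Equiv.refl ι)) (eX.prodCongr (Equiv.refl ι)) := by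
    intro x' y'
    rw [bondDiff_reindex, Matrix.transpose_submatrix, Matrix.submatrix_smul, ← Matrix.submatrix_mul _ _ _ _ _
      Function.bijective_id]
    rfl
  simp_rw [hterm]
  rw [show (∑ x, ∑ y, c x y • ((bondDiff W x y)ᵀ * bondDiff W x y))
      = ∑ x', ∑ y', c (eX x') (eX y') • ((bondDiff W (eX x') (eX y'))ᵀ * bondDiff W (eX x') (eX y')) by
    rw [← eX.sum_comp]; exact Finset.sum_congr rfl fun x' _ => (eX.sum_comp _).symm]
  ext p q
  simp only [Matrix.submatrix_apply, Matrix.sum_apply]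

omit [Fintype X] [Fintype X'] [Fintype Y] [Fintype Y'] [DecidableEq X] [DecidableEq X'] in
/-- parallel transport relabels along the relabelled contour. [folklore] -/
private theorem transport_reindex (eX : X' ≃ X) (W : X → X → Matrix ι ι ℝ) (u : X) (l : List X) :
    transport (fun a b => W (eX a) (eX b)) (eX.symm u) (l.map eX.symm) = transport W u l := by
  induction l generalizing u with
  | nil => rfl
  | cons y l ih => simp only [List.map_cons, transport, ih, Equiv.apply_symm_apply]

omit [Fintype X] [Fintype X'] [Fintype Y] [Fintype Y'] [DecidableEq X] [DecidableEq X'] in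
/-- the contour transporters relabel. [folklore] -/
private theorem contourTrans_reindex (eX : X' ≃ X) (eY : Y' ≃ Y) (W : X → X → Matrix ι ι ℝ) (emb : Y → X)
    (Γ : Y → X → List X) (y' : Y') (x' : X') :
    contourTrans (fun a b => W (eX a) (eX b)) (fun y => eX.symm (emb (eY y)))
        (fun y x => (Γ (eY y) (eX x)).map eX.symm) y' x'
      = contourTrans W emb Γ (eY y') (eX x') := by
  unfold contourTrans
  exact transport_reindex eX W _ _

omit [Fintype X] [Fintype X'] [Fintype Y] [Fintype Y'] [DecidableEq X] [DecidableEq X'] in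
/-- relabelled link variables are the link variables of the relabelled field. [folklore] -/
private theorem fieldLink_reindex (eX : X' ≃ X) (F : OrthFlow ι) (κ : ℝ) (A : X → X → ℝ) :
    fieldLink F κ (fun u v => A (eX u) (eX v)) = fun u v => fieldLink F κ A (eX u) (eX v) := rfl

/-- [B4]'s operator (1.6) relabels. [folklore] -/
private theorem b4Op_reindex (eX : X' ≃ X) (eY : Y' ≃ Y) (F : OrthFlow ι) (κ : ℝ) (c : X → X → ℝ) (m2 a : ℝ)
    (q : Y → X → ℝ) (emb : Y → X) (Γ : Y → X → List X) (A : X → X → ℝ) :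
    b4Op F κ (fun u v => c (eX u) (eX v)) m2 a (fun y x => q (eY y) (eX x)) (fun y => eX.symm (emb (eY y)))
        (fun y x => (Γ (eY y) (eX x)).map eX.symm) (fun u v => A (eX u) (eX v))
      = (b4Op F κ c m2 a q emb Γ A).submatrix (eX.prodCongr (Equiv.refl ι)) (eX.prodCongr (Equiv.refl ι)) := by
  unfold b4Op covOp projOp
  rw [fieldLink_reindex, covLap_reindex]
  have hT : avgOp (fun y x => q (eY y) (eX x))
      (contourTrans (fun a b => fieldLink F κ A (eX a) (eX b)) (fun y => eX.symm (emb (eY y)))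
        (fun y x => (Γ (eY y) (eX x)).map eX.symm))
      = (avgOp q (contourTrans (fieldLink F κ A) emb Γ)).submatrix (eY.prodCongr (Equiv.refl ι)) (eX.prodCongr (Equiv.refl ι)) := by
    unfold avgOp
    rw [← blockOp_reindex]
    congr 1
    funext y' x'
    rw [contourTrans_reindex]
  rw [hT, Matrix.transpose_submatrix, Matrix.submatrix_mul_equiv]
  simp only [Matrix.submatrix_add, Matrix.submatrix_smul, Pi.add_apply, Pi.smul_apply, Matrix.submatrix_one_equiv]

omit [Fintype X] [Fintype X'] [Fintype Y] [Fintype Y'] [Fintype ι] [DecidableEq X] [DecidableEq X'] [DecidableEq ι] in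
/-- dot products are invariant under relabelling. [folklore] -/
private theorem dotProduct_comp_equiv' {α β : Type*} [Fintype α] [Fintype β] (u v : β → ℝ) (e : α ≃ β) :
    (u ∘ e) ⬝ᵥ (v ∘ e) = u ⬝ᵥ v := by
  simp only [dotProduct, Function.comp_apply]
  exact e.sum_comp (fun x => u x * v x)

/-- **THE LEFT SIDE OF (4.7) IS INVARIANT UNDER RELABELLING** of the sites (`eX`) and of the block labels (`eY`),
with all data (bond weights, block weights, block sites, contours, field, `φ`) transported along.
[cite: Balaban1983RegularityDecay, (4.7) p.590, dictionary] -/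
theorem lhs47_reindex (eX : X' ≃ X) (eY : Y' ≃ Y) (F : OrthFlow ι) (κ : ℝ) (c : X → X → ℝ) (m2 a : ℝ)
    (q q' : Y → X → ℝ) (emb : Y → X) (Γ : Y → X → List X) (ak : ℝ) (A : X → X → ℝ) (Ψ : Y × ι → ℝ) :
    lhs47 F κ (fun u v => c (eX u) (eX v)) m2 a (fun y x => q (eY y) (eX x)) (fun y x => q' (eY y) (eX x))
        (fun y => eX.symm (emb (eY y))) (fun y x => (Γ (eY y) (eX x)).map eX.symm) ak (fun u v => A (eX u) (eX v))
        (fun p => Ψ (eY p.1, p.2))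
      = lhs47 F κ c m2 a q q' emb Γ ak A Ψ := by
  unfold lhs47 qgq b4Green
  rw [b4Op_reindex, Matrix.inv_submatrix_equiv]
  have hT : avgOp (fun y x => q' (eY y) (eX x))
      (contourTrans (fieldLink F κ fun u v => A (eX u) (eX v)) (fun y => eX.symm (emb (eY y)))
        (fun y x => (Γ (eY y) (eX x)).map eX.symm))
      = (avgOp q' (contourTrans (fieldLink F κ A) emb Γ)).submatrix (eY.prodCongr (Equiv.refl ι)) (eX.prodCongr (Equiv.refl ι)) := by
    unfold avgOp
    rw [← blockOp_reindex]
    congr 1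
    funext y' x'
    rw [fieldLink_reindex, contourTrans_reindex]
  rw [hT, Matrix.transpose_submatrix, Matrix.submatrix_mul_equiv, Matrix.submatrix_mul_equiv]
  have hΨ : (fun p : Y' × ι => Ψ (eY p.1, p.2)) = Ψ ∘ (eY.prodCongr (Equiv.refl ι)) := rfl
  have hback : (Ψ ∘ ⇑(eY.prodCongr (Equiv.refl ι))) ∘ ⇑(eY.prodCongr (Equiv.refl ι)).symm = Ψ := by
    funext p
    exact congrArg Ψ ((eY.prodCongr (Equiv.refl ι)).apply_symm_apply p)
  rw [hΨ, Matrix.submatrix_mulVec_equiv, hback, dotProduct_comp_equiv', dotProduct_comp_equiv']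

end Reindex

/-! ## §2. (4.12) on the two-block box carrier of `B4Ineq410FirstOrder` -/

section Bridge

variable {d : ℕ} {ι : Type} [Fintype ι] [DecidableEq ι]

omit [Fintype ι] [DecidableEq ι] in
/-- the label set `{x, x′} = {0, e_μ}` of (4.14) IS the unit box of trace `twoBlk μ`.
[cite: Balaban1983RegularityDecay, p.590 «Δ(x,x′) = B^k(x) ∪ B^k(x′)», dictionary] -/
theorem pair_zero_eq (μ : Fin (d + 1)) : pair (0 : Fin (d + 1) → ℤ) μ = boxDom (twoBlk μ) := by
  ext z
  rw [mem_boxDom_twoBlk, pair, Finset.mem_insert, Finset.mem_singleton, zero_add]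
  rfl

omit [Fintype ι] [DecidableEq ι] in
/-- the fine region over `{x, x′}` IS the fine two-block box `Δ(x,x′)`.
[cite: Balaban1983RegularityDecay, p.590 «Δ(x,x′) = B^k(x) ∪ B^k(x′)», dictionary] -/
theorem fineDom_pair_zero_eq {n : ℕ} (hn : 1 ≤ n) (μ : Fin (d + 1)) :
    fineDom n (pair (0 : Fin (d + 1) → ℤ) μ) = boxDom (fun i => n * twoBlk μ i) := by
  rw [pair_zero_eq, fineDom_boxDom hn]

omit [Fintype ι] [DecidableEq ι] in
/-- the end-point of a relabelled contour. [folklore] -/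
private theorem pathEnd_map {X X' : Type*} (e : X' ≃ X) (u : X) (l : List X) :
    pathEnd (e.symm u) (l.map e.symm) = e.symm (pathEnd u l) := by
  induction l generalizing u with
  | nil => rfl
  | cons y l ih => simp only [List.map_cons, pathEnd, ih]

/-- **(4.12) FOR EVERY CONSTANT FIELD ON THE TWO-BLOCK BOX** (the carrier of `B4Ineq410FirstOrder.lhs47Box`; every block
embedding, every contour system whose weighted contours end at the averaged site):
`min(a_k/(8(d+1) + 2m²), 1/8)·|U(κA₀(emb x → emb x′))φ(x′) − φ(x)|² ≤ LHS(4.7)(A₀)` — r01՚s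
`B4Ineq412ConstField.ineq412_constBond_gen` transported along the identifications `{x,x′} = □(twoBlk μ)`,
`fineDom = □(n·twoBlk μ)` by `lhs47_reindex`. [cite: Balaban1983RegularityDecay, (4.12) p.591] -/
theorem ineq412_box {n : ℕ} (hn : 1 ≤ n) {a m2 : ℝ} (ha : 0 < a) (hm : 0 ≤ m2) (μ : Fin (d + 1)) (F : OrthFlow ι)
    (κ : ℝ) (A₀ : Fin (d + 1) → ℝ) (emb : ↥(boxDom (twoBlk μ)) → ↥(boxDom (fun i => n * twoBlk μ i)))
    (Γ : ↥(boxDom (twoBlk μ)) → ↥(boxDom (fun i => n * twoBlk μ i)) → List ↥(boxDom (fun i => n * twoBlk μ i)))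
    (hend : ∀ y x, blkWt n (twoBlk μ) (fun i => n * twoBlk μ i) y x ≠ 0 → pathEnd (emb y) (Γ y x) = x)
    (Ψ : ↥(boxDom (twoBlk μ)) × ι → ℝ) :
    min (a / (8 * (d + 1) + 2 * m2)) (1 / 8)
        * ((F.U (κ * constBond A₀ Subtype.val (emb (siteX μ)) (emb (siteX' μ))) *ᵥ fld Ψ (siteX' μ) - fld Ψ (siteX μ))
            ⬝ᵥ (F.U (κ * constBond A₀ Subtype.val (emb (siteX μ)) (emb (siteX' μ))) *ᵥ fld Ψ (siteX' μ)
              - fld Ψ (siteX μ)))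
      ≤ lhs47Box F κ n a m2 μ emb Γ (constBond A₀ Subtype.val) Ψ := by
  let eY : ↥(pair (0 : Fin (d + 1) → ℤ) μ) ≃ ↥(boxDom (twoBlk μ)) :=
    Equiv.subtypeEquivRight fun z => by rw [pair_zero_eq]
  let eX : ↥(fineDom n (pair (0 : Fin (d + 1) → ℤ) μ)) ≃ ↥(boxDom (fun i => n * twoBlk μ i)) :=
    Equiv.subtypeEquivRight fun z => by rw [fineDom_pair_zero_eq hn]
  have h := ineq412_constBond_gen hn ha hm 0 μ F κ A₀ (fun y => eX.symm (emb (eY y)))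
    (fun y x => (Γ (eY y) (eX x)).map eX.symm) (fun y' x' hq => by
      rw [pathEnd_map, hend (eY y') (eX x') hq, Equiv.symm_apply_apply]) (fun p => Ψ (eY p.1, p.2))
  have hre := lhs47_reindex eX eY F κ (boxWt n (fun i => n * twoBlk μ i)) m2 (a * ((n : ℝ) ^ (d + 1))⁻¹)
    (blkWt n (twoBlk μ) (fun i => n * twoBlk μ i)) (outWtB n μ) emb Γ a (constBond A₀ Subtype.val) Ψ
  have hc : regWt n (pair (0 : Fin (d + 1) → ℤ) μ) = fun u v => boxWt n (fun i => n * twoBlk μ i) (eX u) (eX v) := rfl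
  have hq : blkWtR n (pair (0 : Fin (d + 1) → ℤ) μ) = fun y x => blkWt n (twoBlk μ) (fun i => n * twoBlk μ i) (eY y) (eX x) := rfl
  have hq' : outWt n (pair (0 : Fin (d + 1) → ℤ) μ) = fun y x => outWtB n μ (eY y) (eX x) := rfl
  have hA : (constBond A₀ Subtype.val : ↥(fineDom n (pair (0 : Fin (d + 1) → ℤ) μ)) → _ → ℝ)
      = fun u v => constBond A₀ Subtype.val (eX u) (eX v) := rfl
  rw [← hA] at hre
  rw [hc, hq, hq', hre] at h
  have h0 : eY ⟨0, left_mem_pair 0 μ⟩ = siteX μ := Subtype.ext rfl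
  have h1 : eY ⟨0 + uvec μ, right_mem_pair 0 μ⟩ = siteX' μ :=
    Subtype.ext (by show (0 : Fin (d + 1) → ℤ) + uvec μ = Pi.single μ 1; rw [zero_add]; rfl)
  have hU : constBond A₀ Subtype.val (eX.symm (emb (eY ⟨0, left_mem_pair 0 μ⟩)))
      (eX.symm (emb (eY ⟨0 + uvec μ, right_mem_pair 0 μ⟩)))
      = constBond A₀ Subtype.val (emb (siteX μ)) (emb (siteX' μ)) := by
    rw [h0, h1]; rfl
  have hf0 : fld (fun p : ↥(pair (0 : Fin (d + 1) → ℤ) μ) × ι => Ψ (eY p.1, p.2)) ⟨0, left_mem_pair 0 μ⟩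
      = fld Ψ (siteX μ) := by rw [← h0]; rfl
  have hf1 : fld (fun p : ↥(pair (0 : Fin (d + 1) → ℤ) μ) × ι => Ψ (eY p.1, p.2)) ⟨0 + uvec μ, right_mem_pair 0 μ⟩
      = fld Ψ (siteX' μ) := by rw [← h1]; rfl
  rw [hU, hf0, hf1] at h
  exact h

end Bridge

/-! ## §3. (4.7) for `A = A₀ + A′` on the two-block box: (4.11) + (4.12) + (4.13) -/

section Main

variable {ι : Type} [Fintype ι] [DecidableEq ι]

/-- **[B4] (4.7) ON THE TWO-BLOCK REGION FOR A GENERAL REGULAR FIELD `A = A₀ + A′`, HYPOTHESIS-FREE** — the printed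
conclusion of pp. 590–591: «To prove (4.7) for general, regular A we represent A as a sum A₀ + A′ … Thus we get (4.11) …
Now it is sufficient to prove (4.12) because this together with (4.11) with δ = ½γ₀″ and
|U(A₀(⟨x,x′⟩))φ(x′) − φ(x)|² ≥ ½|U(A(⟨x,x′⟩))φ(x′) − φ(x)|² − O(1)e²p²(e)|φ(x)|² (4.13) give (4.7) with γ₀′ = ¼γ₀″.»
On the model (flow `e^{tq}`, two-block Neumann box `Δ(x,x′)` of the unit bond `⟨x,x′⟩ = ⟨0,e_μ⟩` at scale `n = η^{−1}`,
[B4]՚s weights): there are `γ > 0`, `C ≥ 0` (depending on `d`, `q` and the window `[a₋,a₊] × [0,m²₊]` only) such that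
for all `n ≥ 1`, every direction, coupling, block sites `emb` and nearest-neighbour contours `Γ_{y,z}` of length
`≤ (d+1)n` ending at their targets, every constant `A₀`, every `A′` with `n|κA′_b| ≤ ε₁` on bonds and
`|κA′(Γ_{y,z})| ≤ ε₂` on contours, the Lemma-2.1 smallness `ℓ²ε₁²(d+1)(1+a_k(d+1)) ≤ min(2,a_k)/4`, every
nearest-neighbour contour `Γ_{x,x′}` from `emb x` to `emb x′` of length `≤ 2(d+1)n` (carrying «U(A(⟨x,x′⟩))») and every `φ`:
`γ·|U(κA(Γ_{x,x′}))φ(x′) − φ(x)|² − C(ε₁+ε₂)²(|φ(x)|² + |φ(x′)|²) ≤ a_k|φ|² − a_k²⟨φ, Q_k(A)G_k(Δ(x,x′),A)Q_k^*(A)φ⟩`,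
`γ = ¼γ₀″`, `γ₀″ = min(a₋/(8(d+1) + 2m²₊⁺), 1/8)` ((4.12)/(4.14)), `C = ½γ₀″K′ + K²/γ₀″ + K_R` with `K` of (4.10)
(`B4Ineq410FirstOrder.ineq410_first_constBond`), `K_R` of the remainder (`B4Eq411Remainder.remainder_bound_constBond`),
`K′ = 4(d+1)²ℓ²` of (4.13).  Assembled by r01՚s kernel bookkeeping `B4Ineq410GaugeOut.ineq47_of_412` from (4.11)
[(4.10) + `delta_split` + remainder], (4.12) [`ineq412_box`] and (4.13) [`ineq413_transport`].
[cite: Balaban1983RegularityDecay, (4.7) p.590 with (4.11)–(4.13) p.591] -/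
theorem ineq47_box (d : ℕ) (q : Matrix ι ι ℝ) (hq : qᵀ = -q) (aminus aplus m2plus : ℝ) (ha : 0 < aminus) :
    ∃ γ C : ℝ, 0 < γ ∧ 0 ≤ C ∧ ∀ (n : ℕ) (hn : 1 ≤ n) (a m2 : ℝ), aminus ≤ a → a ≤ aplus → 0 ≤ m2 → m2 ≤ m2plus →
      ∀ (μ : Fin (d + 1)) (κ : ℝ) (emb : ↥(boxDom (twoBlk μ)) → ↥(boxDom (fun i => n * twoBlk μ i)))
        (Γ : ↥(boxDom (twoBlk μ)) → ↥(boxDom (fun i => n * twoBlk μ i)) → List ↥(boxDom (fun i => n * twoBlk μ i))),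
        (∀ y x, blkWt n (twoBlk μ) (fun i => n * twoBlk μ i) y x ≠ 0 → pathEnd (emb y) (Γ y x) = x) →
        (∀ y x, blkWt n (twoBlk μ) (fun i => n * twoBlk μ i) y x ≠ 0 →
          PathRel (fun u v : ↥(boxDom (fun i => n * twoBlk μ i)) => v.1 ∈ nbrs u.1) (emb y) (Γ y x)) →
        (∀ y x, blkWt n (twoBlk μ) (fun i => n * twoBlk μ i) y x ≠ 0 → ((Γ y x).length : ℝ) ≤ (d + 1) * n) →
        ∀ (A₀ : Fin (d + 1) → ℝ)
        (A' : ↥(boxDom (fun i => n * twoBlk μ i)) → ↥(boxDom (fun i => n * twoBlk μ i)) → ℝ) (ε₁ ε₂ : ℝ),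
        0 ≤ ε₁ → 0 ≤ ε₂ →
        (∀ x y : ↥(boxDom (fun i => n * twoBlk μ i)), y.1 ∈ nbrs x.1 → (n : ℝ) * |κ * A' x y| ≤ ε₁) →
        (∀ (y : ↥(boxDom (twoBlk μ))) (x : ↥(boxDom (fun i => n * twoBlk μ i))), blk n x.1 = y.1 →
          |κ * lsum A' (emb y) (Γ y x)| ≤ ε₂) →
        (∑ i, ∑ j, q i j ^ 2) * ε₁ ^ 2 * ((d : ℝ) + 1) * (1 + a * ((d : ℝ) + 1)) ≤ min 2 a / 4 →
        ∀ (l : List ↥(boxDom (fun i => n * twoBlk μ i))),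
        PathRel (fun u v : ↥(boxDom (fun i => n * twoBlk μ i)) => v.1 ∈ nbrs u.1) (emb (siteX μ)) l →
        pathEnd (emb (siteX μ)) l = emb (siteX' μ) → (l.length : ℝ) ≤ 2 * ((d : ℝ) + 1) * n →
        ∀ Ψ : ↥(boxDom (twoBlk μ)) × ι → ℝ,
          γ * siteNorm (transport (fieldLink (expFlow q hq) κ (constBond A₀ Subtype.val + A')) (emb (siteX μ)) l
                  *ᵥ fld Ψ (siteX' μ) - fld Ψ (siteX μ)) ^ 2
              - C * (ε₁ + ε₂) ^ 2 * (siteNorm (fld Ψ (siteX μ)) ^ 2 + siteNorm (fld Ψ (siteX' μ)) ^ 2)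
            ≤ lhs47Box (expFlow q hq) κ n a m2 μ emb Γ (constBond A₀ Subtype.val + A') Ψ := by
  obtain ⟨K, hK, hF⟩ := ineq410_first_constBond d q hq aminus aplus m2plus ha
  obtain ⟨K_R, hK_R, hR⟩ := remainder_bound_constBond d q hq aminus aplus m2plus ha
  have hden : 0 < 8 * ((d : ℝ) + 1) + 2 * max m2plus 0 := by positivity
  have hγ : 0 < min (aminus / (8 * ((d : ℝ) + 1) + 2 * max m2plus 0)) (1 / 8) :=
    lt_min (div_pos ha hden) (by norm_num)
  have hK'0 : 0 ≤ 4 * ((d : ℝ) + 1) ^ 2 * Real.sqrt (∑ i, ∑ j, q i j ^ 2) ^ 2 := by positivity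
  refine ⟨min (aminus / (8 * ((d : ℝ) + 1) + 2 * max m2plus 0)) (1 / 8) / 4,
    min (aminus / (8 * ((d : ℝ) + 1) + 2 * max m2plus 0)) (1 / 8) / 2
        * (4 * ((d : ℝ) + 1) ^ 2 * Real.sqrt (∑ i, ∑ j, q i j ^ 2) ^ 2)
      + (K ^ 2 / min (aminus / (8 * ((d : ℝ) + 1) + 2 * max m2plus 0)) (1 / 8) + K_R),
    div_pos hγ (by norm_num),
    add_nonneg (mul_nonneg (half_pos hγ).le hK'0) (add_nonneg (div_nonneg (sq_nonneg K) hγ.le) hK_R), ?_⟩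
  intro n hn a m2 h1 h2 h3 h4 μ κ emb Γ hend hnn hlen A₀ A' ε₁ ε₂ hε₁ hε₂ hA1 hA2 hsmall l hl hlend hllen Ψ
  have ha' : 0 < a := lt_of_lt_of_le ha h1
  have hn' : (0 : ℝ) < n := by exact_mod_cast hn
  have hd0 : (0 : ℝ) ≤ d := Nat.cast_nonneg d
  -- (4.10) + the δ-split at δ = ½γ₀″  (`W = |φ(x)|² + |φ(x′)|²`, `E = ε₁ + ε₂`)
  have hF' := (hF n hn a m2 h1 h2 h3 h4 μ κ emb Γ hend A₀ A' ε₁ ε₂ hε₁ hε₂ hA1 hA2 Ψ).trans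
    (delta_split K (ε₁ + ε₂)
      (siteNorm ((expFlow q hq).U (κ * constBond A₀ Subtype.val (emb (siteX μ)) (emb (siteX' μ))) *ᵥ fld Ψ (siteX' μ)
        - fld Ψ (siteX μ)))
      (siteNorm (fld Ψ (siteX μ))) (siteNorm (fld Ψ (siteX' μ))) (half_pos hγ))
  -- the remainder
  have hR' := hR n hn a m2 h1 h2 h3 h4 μ κ emb Γ hend hnn hlen A₀ A' ε₁ ε₂ hε₁ hε₂ hA1 hA2 hsmall Ψ
  -- (4.12) on the box, with the window constant `γ₀″ ≤ min(a/(8(d+1)+2m²), 1/8)`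
  have h412 : min (aminus / (8 * ((d : ℝ) + 1) + 2 * max m2plus 0)) (1 / 8)
      * siteNorm ((expFlow q hq).U (κ * constBond A₀ Subtype.val (emb (siteX μ)) (emb (siteX' μ))) *ᵥ fld Ψ (siteX' μ)
          - fld Ψ (siteX μ)) ^ 2
      ≤ lhs47Box (expFlow q hq) κ n a m2 μ emb Γ (constBond A₀ Subtype.val) Ψ := by
    have h0 := ineq412_box hn ha' h3 μ (expFlow q hq) κ A₀ emb Γ hend Ψ
    rw [← siteNorm_sq] at h0
    have hden' : 0 < 8 * ((d : ℝ) + 1) + 2 * m2 := by linarith only [hd0, h3]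
    have hmin : min (aminus / (8 * ((d : ℝ) + 1) + 2 * max m2plus 0)) (1 / 8)
        ≤ min (a / (8 * (d + 1) + 2 * m2)) (1 / 8) := by
      refine le_min ((min_le_left _ _).trans ?_) (min_le_right _ _)
      rw [div_le_div_iff₀ hden hden']
      have hm' : 2 * m2 ≤ 2 * max m2plus 0 := by linarith only [h4, le_max_left m2plus 0]
      have e1 : aminus * (8 * ((d : ℝ) + 1)) ≤ a * (8 * ((d : ℝ) + 1)) :=
        mul_le_mul_of_nonneg_right h1 (by linarith only [hd0])
      have e2 : aminus * (2 * m2) ≤ a * (2 * max m2plus 0) := mul_le_mul h1 hm' (by linarith only [h3]) ha'.le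
      linarith only [e1, e2]
    exact (mul_le_mul_of_nonneg_right hmin (sq_nonneg _)).trans h0
  -- (4.13) along the contour `Γ_{x,x′}` (`θ = 2(d+1)ε₁`, `K′ = 4(d+1)²ℓ²`)
  have h413 : siteNorm (transport (fieldLink (expFlow q hq) κ (constBond A₀ Subtype.val + A')) (emb (siteX μ)) l
          *ᵥ fld Ψ (siteX' μ) - fld Ψ (siteX μ)) ^ 2 / 2
        - 4 * ((d : ℝ) + 1) ^ 2 * Real.sqrt (∑ i, ∑ j, q i j ^ 2) ^ 2 * (ε₁ + ε₂) ^ 2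
          * (siteNorm (fld Ψ (siteX μ)) ^ 2 + siteNorm (fld Ψ (siteX' μ)) ^ 2)
      ≤ siteNorm ((expFlow q hq).U (κ * constBond A₀ Subtype.val (emb (siteX μ)) (emb (siteX' μ))) *ᵥ fld Ψ (siteX' μ)
          - fld Ψ (siteX μ)) ^ 2 := by
    have hρ : ∀ u u' : ↥(boxDom (fun i => n * twoBlk μ i)), u'.1 ∈ nbrs u.1 → |κ * A' u u'| ≤ ε₁ / n := by
      intro u u' huu'
      rw [le_div_iff₀ hn', mul_comm]
      exact hA1 u u' huu'
    have hθ : (l.length : ℝ) * (ε₁ / n) ≤ 2 * ((d : ℝ) + 1) * ε₁ := by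
      have e1 : (l.length : ℝ) * (ε₁ / n) ≤ 2 * ((d : ℝ) + 1) * n * (ε₁ / n) :=
        mul_le_mul_of_nonneg_right hllen (div_nonneg hε₁ hn'.le)
      have e2 : 2 * ((d : ℝ) + 1) * n * (ε₁ / n) = 2 * ((d : ℝ) + 1) * ε₁ := by
        rw [mul_assoc, mul_div_cancel₀ _ hn'.ne']
      linarith only [e1, e2]
    have h0 := ineq413_transport (expFlow q hq) (expFlow_lipschitz q hq) κ (constBond A₀ Subtype.val) A' hρ hl hθ
      (fld Ψ (siteX μ)) (fld Ψ (siteX' μ))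
    rw [transport_constBond, hlend, ← siteNorm_sq, ← siteNorm_sq, ← siteNorm_sq] at h0
    have hε : ε₁ ^ 2 ≤ (ε₁ + ε₂) ^ 2 := by nlinarith only [hε₁, hε₂]
    have hvW : siteNorm (fld Ψ (siteX μ)) ^ 2 ≤ siteNorm (fld Ψ (siteX μ)) ^ 2 + siteNorm (fld Ψ (siteX' μ)) ^ 2 :=
      le_add_of_nonneg_right (sq_nonneg _)
    have herr : (Real.sqrt (∑ i, ∑ j, q i j ^ 2) * (2 * ((d : ℝ) + 1) * ε₁)) ^ 2 * siteNorm (fld Ψ (siteX μ)) ^ 2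
        ≤ 4 * ((d : ℝ) + 1) ^ 2 * Real.sqrt (∑ i, ∑ j, q i j ^ 2) ^ 2 * (ε₁ + ε₂) ^ 2
          * (siteNorm (fld Ψ (siteX μ)) ^ 2 + siteNorm (fld Ψ (siteX' μ)) ^ 2) := by
      have e1 : (Real.sqrt (∑ i, ∑ j, q i j ^ 2) * (2 * ((d : ℝ) + 1) * ε₁)) ^ 2
          = 4 * ((d : ℝ) + 1) ^ 2 * Real.sqrt (∑ i, ∑ j, q i j ^ 2) ^ 2 * ε₁ ^ 2 := by ring
      rw [e1]
      exact mul_le_mul (mul_le_mul_of_nonneg_left hε hK'0) hvW (sq_nonneg _) (mul_nonneg hK'0 (sq_nonneg _))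
    linarith only [h0, herr]
  exact ineq47_of_412 hγ (by ring) hF' hR' h412 h413

end Main

/-! ## §4. The canonical data: base-corner block sites, [B4]'s staircase contours, the straight bond contour -/

section Canonical

variable {d : ℕ}

/-- the base corners `n·x = 0 ≤ n·x′ = n·e_μ` of the two blocks, componentwise. [folklore] -/
private theorem base_le {n : ℕ} (hn : 1 ≤ n) (μ : Fin (d + 1)) :
    (baseEmb hn (twoBlk μ) (siteX μ)).1 ≤ (baseEmb hn (twoBlk μ) (siteX' μ)).1 := by
  intro i
  show (n : ℤ) * (siteX μ).1 i ≤ (n : ℤ) * (siteX' μ).1 i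
  refine mul_le_mul_of_nonneg_left ?_ (by positivity)
  simp only [siteX, siteX', Pi.zero_apply, Pi.single_apply]
  split_ifs <;> norm_num

/-- the steps of the straight bond contour in each coordinate are `≤ n`. [folklore] -/
private theorem base_sub_le {n : ℕ} (hn : 1 ≤ n) (μ : Fin (d + 1)) (j : Fin (d + 1)) :
    (baseEmb hn (twoBlk μ) (siteX' μ)).1 j - (baseEmb hn (twoBlk μ) (siteX μ)).1 j ≤ n := by
  show (n : ℤ) * (siteX' μ).1 j - (n : ℤ) * (siteX μ).1 j ≤ n
  simp only [siteX, siteX', Pi.zero_apply, Pi.single_apply, mul_zero, sub_zero]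
  split_ifs <;> simp

/-- **THE BOND CONTOUR `Γ_{x,x′}`** carrying «U(A(⟨x,x′⟩))»: the straight nearest-neighbour contour of the fine lattice
from the base corner `n·x = 0` of `B^k(x)` to the base corner `n·x′ = n·e_μ` of `B^k(x′)` (`n` steps in direction `μ`).
[cite: Balaban1983RegularityDecay, (4.7) p.590 «U(A(⟨x,x′⟩))», p.572 «A(Γ) = Σ_{b⊂Γ}A_b», dictionary] -/
noncomputable def bondContour {n : ℕ} (hn : 1 ≤ n) (μ : Fin (d + 1)) : List ↥(boxDom (fun i => n * twoBlk μ i)) :=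
  (stair (baseEmb hn (twoBlk μ) (siteX μ)).1 (baseEmb hn (twoBlk μ) (siteX' μ)).1).pmap Subtype.mk
    (fun _ hz => mem_boxDom_of_between (baseEmb hn (twoBlk μ) (siteX μ)).2 (baseEmb hn (twoBlk μ) (siteX' μ)).2
      (mem_stair (base_le hn μ) hz).1 (mem_stair (base_le hn μ) hz).2)

/-- the bond contour is a nearest-neighbour contour from `n·x`. [cite: Balaban1983RegularityDecay, p.572 «Γ^{(k)}_{y,x}», dictionary] -/
theorem bondContour_nn {n : ℕ} (hn : 1 ≤ n) (μ : Fin (d + 1)) :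
    PathRel (fun u v : ↥(boxDom (fun i => n * twoBlk μ i)) => v.1 ∈ nbrs u.1) (baseEmb hn (twoBlk μ) (siteX μ))
      (bondContour hn μ) :=
  (pathRel_pmap_iff (r := fun u v => v ∈ nbrs u) _ _ (baseEmb hn (twoBlk μ) (siteX μ)).2 _).2
    (pathRel_stair (base_le hn μ))

/-- the bond contour ends at `n·x′`. [cite: Balaban1983RegularityDecay, p.572 «Γ^{(k)}_{y,x}», dictionary] -/
theorem bondContour_end {n : ℕ} (hn : 1 ≤ n) (μ : Fin (d + 1)) :
    pathEnd (baseEmb hn (twoBlk μ) (siteX μ)) (bondContour hn μ) = baseEmb hn (twoBlk μ) (siteX' μ) := by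
  apply Subtype.ext
  rw [bondContour, val_pathEnd_pmap]
  exact pathEnd_stair (base_le hn μ)

/-- the bond contour has `≤ (d+1)n ≤ 2(d+1)n` steps (in fact `n`). [cite: Balaban1983RegularityDecay, p.572 «Γ^{(k)}_{y,x}», dictionary] -/
theorem bondContour_length {n : ℕ} (hn : 1 ≤ n) (μ : Fin (d + 1)) :
    ((bondContour hn μ).length : ℝ) ≤ 2 * ((d : ℝ) + 1) * n := by
  rw [bondContour, List.length_pmap]
  have h := length_stair_le (base_le hn μ) (base_sub_le hn μ)
  have h' : ((stair (baseEmb hn (twoBlk μ) (siteX μ)).1 (baseEmb hn (twoBlk μ) (siteX' μ)).1).length : ℝ)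
      ≤ ((d : ℝ) + 1) * n := by exact_mod_cast h
  have hdn : 0 ≤ ((d : ℝ) + 1) * n := by positivity
  linarith

variable {ι : Type} [Fintype ι] [DecidableEq ι]

/-- **[B4] (4.7) FOR `A = A₀ + A′` WITH THE CANONICAL DATA** — block averages based at the corners `n·y`, [B4]'s
staircase contours `Γ^{(k)}_{y,z}` (`B4Lower18Regular.stairContour`), the straight bond contour `Γ_{x,x′}`
(`bondContour`), and the contour bound `|κA′(Γ_{y,z})| ≤ (d+1)ε₁` DERIVED from the bond bound (`abs_lsum_le`): the only
hypotheses left are the print's — the window, the bond bound `n|κA′_b| ≤ ε₁` («|A′| ≤ O(1)p(e)», `κ = eη`) and the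
Lemma-2.1 smallness —, and the conclusion is (4.7) with `O(1)e²p²(e) = C·ε₁²`:
`γ|U(κA(Γ_{x,x′}))φ(x′) − φ(x)|² − Cε₁²(|φ(x)|² + |φ(x′)|²) ≤ a_k|φ|² − a_k²⟨φ, Q_k(A)G_k(Δ(x,x′),A)Q_k^*(A)φ⟩`.
[cite: Balaban1983RegularityDecay, (4.7) p.590 with (4.11)–(4.13) p.591] -/
theorem ineq47_box_canonical (d : ℕ) (q : Matrix ι ι ℝ) (hq : qᵀ = -q) (aminus aplus m2plus : ℝ) (ha : 0 < aminus) :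
    ∃ γ C : ℝ, 0 < γ ∧ 0 ≤ C ∧ ∀ (n : ℕ) (hn : 1 ≤ n) (a m2 : ℝ), aminus ≤ a → a ≤ aplus → 0 ≤ m2 → m2 ≤ m2plus →
      ∀ (μ : Fin (d + 1)) (κ : ℝ) (A₀ : Fin (d + 1) → ℝ)
        (A' : ↥(boxDom (fun i => n * twoBlk μ i)) → ↥(boxDom (fun i => n * twoBlk μ i)) → ℝ) (ε₁ : ℝ), 0 ≤ ε₁ →
        (∀ x y : ↥(boxDom (fun i => n * twoBlk μ i)), y.1 ∈ nbrs x.1 → (n : ℝ) * |κ * A' x y| ≤ ε₁) →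
        (∑ i, ∑ j, q i j ^ 2) * ε₁ ^ 2 * ((d : ℝ) + 1) * (1 + a * ((d : ℝ) + 1)) ≤ min 2 a / 4 →
        ∀ Ψ : ↥(boxDom (twoBlk μ)) × ι → ℝ,
          γ * siteNorm (transport (fieldLink (expFlow q hq) κ (constBond A₀ Subtype.val + A'))
                  (baseEmb hn (twoBlk μ) (siteX μ)) (bondContour hn μ) *ᵥ fld Ψ (siteX' μ) - fld Ψ (siteX μ)) ^ 2
              - C * ε₁ ^ 2 * (siteNorm (fld Ψ (siteX μ)) ^ 2 + siteNorm (fld Ψ (siteX' μ)) ^ 2)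
            ≤ lhs47Box (expFlow q hq) κ n a m2 μ (baseEmb hn (twoBlk μ)) (stairContour hn (twoBlk μ))
                (constBond A₀ Subtype.val + A') Ψ := by
  obtain ⟨γ, C, hγ, hC, h⟩ := ineq47_box d q hq aminus aplus m2plus ha
  refine ⟨γ, C * ((d : ℝ) + 2) ^ 2, hγ, by positivity, ?_⟩
  intro n hn a m2 h1 h2 h3 h4 μ κ A₀ A' ε₁ hε₁ hA1 hsmall Ψ
  have hn' : (0 : ℝ) < n := by exact_mod_cast hn
  have hd1 : (0 : ℝ) ≤ (d : ℝ) + 1 := by positivity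
  have hρ : ∀ u u' : ↥(boxDom (fun i => n * twoBlk μ i)), u'.1 ∈ nbrs u.1 → |κ * A' u u'| ≤ ε₁ / n := by
    intro u u' huu'
    rw [le_div_iff₀ hn', mul_comm]
    exact hA1 u u' huu'
  have hA2 : ∀ (y : ↥(boxDom (twoBlk μ))) (x : ↥(boxDom (fun i => n * twoBlk μ i))), blk n x.1 = y.1 →
      |κ * lsum A' (baseEmb hn (twoBlk μ) y) (stairContour hn (twoBlk μ) y x)| ≤ ((d : ℝ) + 1) * ε₁ := by
    intro y x _
    have h0 := abs_lsum_le hρ _ _ (stairContour_nn hn (twoBlk μ) y x)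
    have hl := stairContour_length hn (twoBlk μ) y x
    have e1 : ((stairContour hn (twoBlk μ) y x).length : ℝ) * (ε₁ / n) ≤ ((d : ℝ) + 1) * n * (ε₁ / n) :=
      mul_le_mul_of_nonneg_right hl (div_nonneg hε₁ hn'.le)
    have e2 : ((d : ℝ) + 1) * n * (ε₁ / n) = ((d : ℝ) + 1) * ε₁ := by rw [mul_assoc, mul_div_cancel₀ _ hn'.ne']
    linarith only [h0, e1, e2]
  have h0 := h n hn a m2 h1 h2 h3 h4 μ κ (baseEmb hn (twoBlk μ)) (stairContour hn (twoBlk μ))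
    (fun y x hq => stairContour_end hn (twoBlk μ) y x hq) (fun y x _ => stairContour_nn hn (twoBlk μ) y x)
    (fun y x _ => stairContour_length hn (twoBlk μ) y x) A₀ A' ε₁ (((d : ℝ) + 1) * ε₁) hε₁ (mul_nonneg hd1 hε₁) hA1
    hA2 hsmall (bondContour hn μ) (bondContour_nn hn μ) (bondContour_end hn μ) (bondContour_length hn μ) Ψ
  have e : C * (ε₁ + ((d : ℝ) + 1) * ε₁) ^ 2 * (siteNorm (fld Ψ (siteX μ)) ^ 2 + siteNorm (fld Ψ (siteX' μ)) ^ 2)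
      = C * ((d : ℝ) + 2) ^ 2 * ε₁ ^ 2 * (siteNorm (fld Ψ (siteX μ)) ^ 2 + siteNorm (fld Ψ (siteX' μ)) ^ 2) := by
    ring
  linarith only [h0, e]

end Canonical

end

end Literature.MathematicalPhysics.QuantumFieldTheory.Balaban1983to89.B4Ineq47TwoBlock
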